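import Mathlib
import Summits.AtomisticToContinuum.FouriersLaw.Theorems.EmbeddedDrudeMourreMourreDissolutionFibreLorentzianLocal
import HarnessLib

/-!
# Lorentzian regularisation of a delta function along a fibre, II: the fibre lemma

Helper file for crux `EmbeddedDrudeMourre.MourreDissolution` (item stmt-AtomisticToContinuum-12594,
line `swap-odd-threshold-rigidity`, stub B `stub_freeLevelShift`).

`tendsto_setIntegral_lorentzian_of_simple_zeros`: for `g, φ` continuous on `[a, b]` and a finite
set `Z ⊂ (a, b)` containing every zero of `g` on `[a, b]`, each simple (`g` differentiable there,
`g'(z) ≠ 0`),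
`∫_{(a,b]} φ(x) ν/(g(x)² + ν²) dx → π Σ_{z ∈ Z} φ(z)/|g'(z)|` as `ν ↓ 0`,
i.e. `ν/(g² + ν²) ⇀ π δ(g) = π Σ_z δ_z/|g'(z)|`. This is the fibrewise form of "Fermi golden rule =
resolved energy delta" used for the free level shift of the pinned chain (`collisionWeight` carries
exactly the Jacobian `|∂₂Ω|⁻¹ = resonanceJacobian⁻¹`).
Proof: split `(a, b]` into the disjoint near intervals `(z-r, z+r]` and the far region; near each
zero Part I gives the value `φ(z)·2arctan(|g'(z)|r/ν)/|g'(z)| → πφ(z)/|g'(z)|` up to `O(ε)` uniformly in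
`ν`; on the far region `|g| ≥ c > 0` and the integrand is `O(ν)`.
-/

noncomputable section

namespace Summit.AtomisticToContinuum.FouriersLaw.Theorems.MourreDissolution.FibreLorentzian

open MeasureTheory Filter Set Topology Real

/-! ## 5. The fibre lemma -/

/-- **Lorentzian regularisation of the delta function of `g` (fibre lemma).** Let `g, φ` be
continuous on `[a, b]` and let the finite set `Z ⊂ (a, b)` contain every zero of `g` on `[a, b]`,
each zero being simple (`g` differentiable there with `g' z ≠ 0`). Then
`∫_{(a,b]} φ(x) ν/(g(x)² + ν²) dx → π Σ_{z ∈ Z} φ(z)/|g'(z)|` as `ν ↓ 0`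
— i.e. `ν/(g²+ν²) ⇀ π δ(g) = π Σ δ(x - z)/|g'(z)|`. [folklore] -/
theorem tendsto_setIntegral_lorentzian_of_simple_zeros' {a b : ℝ} (hab : a ≤ b) {g g' φ : ℝ → ℝ}
    (hgc : ContinuousOn g (Icc a b)) (hφ : ContinuousOn φ (Icc a b)) (Z : Finset ℝ)
    (hZ : ∀ z ∈ Z, z ∈ Ioo a b ∧ g z = 0 ∧ HasDerivAt g (g' z) z ∧ g' z ≠ 0)
    (hnz : ∀ x ∈ Icc a b, g x = 0 → x ∈ Z) :
    Tendsto (fun ν : ℝ => ∫ x in Ioc a b, φ x * (ν / (g x ^ 2 + ν ^ 2))) (𝓝[>] 0)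
      (𝓝 (Real.pi * ∑ z ∈ Z, φ z / |g' z|)) := by
  rw [Metric.tendsto_nhds]
  intro η hη
  -- constants attached to the zeros
  set Kz : ℝ → ℝ := fun z => 2 * Real.pi / |g' z| + 10 * Real.pi * |φ z| / |g' z| ^ 2 with hKz
  have hKz0 : ∀ z ∈ Z, 0 ≤ Kz z := fun z _ => by positivity
  set S : ℝ := ∑ z ∈ Z, Kz z with hSdef
  have hS0 : 0 ≤ S := Finset.sum_nonneg hKz0
  -- a bound for `φ`
  obtain ⟨M, hM⟩ := isCompact_Icc.exists_bound_of_continuousOn hφ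
  have hM0 : 0 ≤ M := le_trans (norm_nonneg _) (hM a (left_mem_Icc.2 hab))
  -- the tolerance `ε`
  obtain ⟨ε₁, hε₁, hε₁Z⟩ := exists_pos_forall_le Z (fun z => |g' z| / 2)
    (fun z hz => by have := abs_pos.2 (hZ z hz).2.2.2; positivity)
  set ε : ℝ := min ε₁ (η / (3 * (S + 1))) with hεdef
  have hε : 0 < ε := lt_min hε₁ (by positivity)
  have hεZ : ∀ z ∈ Z, ε ≤ |g' z| / 2 := fun z hz => (min_le_left _ _).trans (hε₁Z z hz)
  have hεS : ε * S ≤ η / 3 := by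
    have h1 : ε ≤ η / (3 * (S + 1)) := min_le_right _ _
    calc ε * S ≤ η / (3 * (S + 1)) * S := mul_le_mul_of_nonneg_right h1 hS0
      _ ≤ η / 3 := by
          rw [div_mul_eq_mul_div, div_le_div_iff₀ (by positivity) (by positivity)]
          nlinarith
  -- radii at the zeros
  have hrad : ∀ z ∈ Z, ∃ ρ : ℝ, 0 < ρ ∧ Icc (z - ρ) (z + ρ) ⊆ Ioo a b ∧
      (∀ x, |x - z| ≤ ρ → |g x - g' z * (x - z)| ≤ ε * |x - z|) ∧
      (∀ x, |x - z| ≤ ρ → |φ x - φ z| ≤ ε) := by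
    intro z hz
    obtain ⟨hzI, hgz, hder, _⟩ := hZ z hz
    have hφz : ContinuousAt φ z := hφ.continuousAt (Icc_mem_nhds hzI.1 hzI.2)
    obtain ⟨ρ, hρ, hsub, hg1, hφ1⟩ := exists_radius_at_zero hzI hder hφz hε
    refine ⟨ρ, hρ, hsub, fun x hx => ?_, hφ1⟩
    have := hg1 x hx
    rwa [hgz, sub_zero] at this
  choose! ρ hρ hρsub hρg hρφ using hrad
  obtain ⟨r₁, hr₁, hr₁Z⟩ := exists_pos_forall_le Z ρ hρ
  obtain ⟨r₂, hr₂, hr₂Z⟩ := exists_pos_forall_le ((Z ×ˢ Z).filter (fun p => p.1 ≠ p.2))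
    (fun p => |p.1 - p.2| / 3) (by
      intro p hp
      rw [Finset.mem_filter] at hp
      have : p.1 - p.2 ≠ 0 := sub_ne_zero.2 hp.2
      positivity)
  set r : ℝ := min r₁ r₂ with hrdef
  have hr : 0 < r := lt_min hr₁ hr₂
  have hrρ : ∀ z ∈ Z, r ≤ ρ z := fun z hz => (min_le_left _ _).trans (hr₁Z z hz)
  have hrsep : ∀ z ∈ Z, ∀ z' ∈ Z, z ≠ z' → 3 * r ≤ |z - z'| := by
    intro z hz z' hz' hne
    have h := hr₂Z (z, z') (by simp [hz, hz', hne])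
    have hr2 : r ≤ r₂ := min_le_right _ _
    linarith
  -- the far region
  obtain ⟨c, hc, hcfar⟩ := exists_pos_le_abs_far hgc Z hnz hr
  -- eventual smallness in `ν`
  have hev1 : ∀ᶠ ν in 𝓝[>] (0:ℝ), M / c ^ 2 * (b - a) * ν < η / 3 := by
    have h : Tendsto (fun ν : ℝ => M / c ^ 2 * (b - a) * ν) (𝓝 0) (𝓝 (M / c ^ 2 * (b - a) * 0)) :=
      (continuous_const.mul continuous_id).tendsto 0
    rw [mul_zero] at h
    exact (h.mono_left nhdsWithin_le_nhds) (Iio_mem_nhds (by positivity))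
  have hev2 : ∀ᶠ ν in 𝓝[>] (0:ℝ), ∀ z ∈ Z,
      |φ z| * abs (2 * Real.arctan (|g' z| * r / ν) / |g' z| - Real.pi / |g' z|) <
        η / (3 * (Z.card + 1)) := by
    rw [eventually_all_finset]
    intro z hz
    have ht := tendsto_two_mul_arctan_div (hZ z hz).2.2.2 hr
    have ht2 : Tendsto (fun ν : ℝ =>
        |φ z| * abs (2 * Real.arctan (|g' z| * r / ν) / |g' z| - Real.pi / |g' z|)) (𝓝[>] 0)
        (𝓝 (|φ z| * 0)) := by
      refine Tendsto.const_mul _ ?_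
      have := (tendsto_iff_norm_sub_tendsto_zero.1 ht)
      simpa only [Real.norm_eq_abs] using this
    rw [mul_zero] at ht2
    exact ht2 (Iio_mem_nhds (by positivity))
  filter_upwards [hev1, hev2, self_mem_nhdsWithin] with ν hν1 hν2 hνpos
  have hνpos' : (0:ℝ) < ν := hνpos
  -- the integrand for this `ν`
  set F : ℝ → ℝ := fun x => φ x * (ν / (g x ^ 2 + ν ^ 2)) with hF
  have hFcont : ContinuousOn F (Icc a b) := by
    refine hφ.mul (continuousOn_const.div ((hgc.pow 2).add continuousOn_const) (fun x _ => ?_))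
    positivity
  have hFint : IntegrableOn F (Icc a b) := hFcont.integrableOn_Icc
  have hFintIoc : IntegrableOn F (Ioc a b) := hFint.mono_set Ioc_subset_Icc_self
  -- the near intervals
  set B : ℝ → Set ℝ := fun z => Ioc (z - r) (z + r) with hB
  have hBIcc : ∀ z ∈ Z, Icc (z - r) (z + r) ⊆ Icc a b := by
    intro z hz x hx
    have hsub := hρsub z hz
    have hx' : x ∈ Icc (z - ρ z) (z + ρ z) :=
      ⟨by linarith [hx.1, hrρ z hz], by linarith [hx.2, hrρ z hz]⟩
    exact Ioo_subset_Icc_self (hsub hx')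
  have hBsub : ∀ z ∈ Z, B z ⊆ Ioc a b := by
    intro z hz x hx
    have hsub := hρsub z hz
    have hx' : x ∈ Icc (z - ρ z) (z + ρ z) :=
      ⟨by linarith [hx.1, hrρ z hz], by linarith [hx.2, hrρ z hz]⟩
    exact Ioo_subset_Ioc_self (hsub hx')
  have hdisj : Set.PairwiseDisjoint (↑Z : Set ℝ) B := by
    intro z hz z' hz' hne
    rw [Function.onFun, Set.disjoint_left]
    intro x hx hx'
    have h3 := hrsep z hz z' hz' hne
    have h1 : |x - z| ≤ r := abs_le.2 ⟨by linarith [hx.1], by linarith [hx.2]⟩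
    have h2 : |x - z'| ≤ r := abs_le.2 ⟨by linarith [hx'.1], by linarith [hx'.2]⟩
    have : |z - z'| ≤ |x - z| + |x - z'| := by
      calc |z - z'| = |(x - z') - (x - z)| := by ring_nf
        _ ≤ |x - z'| + |x - z| := abs_sub _ _
        _ = |x - z| + |x - z'| := add_comm _ _
    linarith
  set U : Set ℝ := ⋃ z ∈ Z, B z with hU
  have hUmeas : MeasurableSet U := Finset.measurableSet_biUnion _ (fun z _ => measurableSet_Ioc)
  have hUsub : U ⊆ Ioc a b := Set.iUnion₂_subset hBsub
  have hsplit : ∫ x in Ioc a b, F x = (∫ x in Ioc a b \ U, F x) + ∫ x in U, F x := by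
    rw [setIntegral_sdiff hUmeas hFintIoc hUsub]; ring
  have hUsum : ∫ x in U, F x = ∑ z ∈ Z, ∫ x in B z, F x :=
    integral_biUnion_finset Z (fun z _ => measurableSet_Ioc) hdisj
      (fun z hz => hFintIoc.mono_set (hBsub z hz))
  -- near estimate at each zero
  have hnear : ∀ z ∈ Z, |(∫ x in B z, F x) - Real.pi * (φ z / |g' z|)| ≤
      ε * Kz z + |φ z| * abs (2 * Real.arctan (|g' z| * r / ν) / |g' z| - Real.pi / |g' z|) := by
    intro z hz
    have hs := (hZ z hz).2.2.2
    have hzr : z - r ≤ z + r := by linarith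
    have e1 : ∫ x in B z, F x = ∫ x in (z - r)..(z + r), F x :=
      (intervalIntegral.integral_of_le hzr).symm
    have hint : IntervalIntegrable F volume (z - r) (z + r) := by
      refine (hFint.mono_set ?_).intervalIntegrable
      rw [Set.uIcc_of_le hzr]
      exact hBIcc z hz
    have hg1 : ∀ x ∈ Icc (z - r) (z + r), |g x - g' z * (x - z)| ≤ ε * |x - z| := fun x hx =>
      hρg z hz x ((abs_le.2 ⟨by linarith [hx.1], by linarith [hx.2]⟩).trans (hrρ z hz))
    have hφ1 : ∀ x ∈ Icc (z - r) (z + r), |φ x - φ z| ≤ ε := fun x hx =>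
      hρφ z hz x ((abs_le.2 ⟨by linarith [hx.1], by linarith [hx.2]⟩).trans (hrρ z hz))
    have key := abs_integral_near_zero_sub_le' hνpos' hr.le hε.le (hεZ z hz) hs hg1 hφ1 hint
    set T : ℝ := 2 * Real.arctan (|g' z| * r / ν) / |g' z| with hT
    rw [e1]
    calc |(∫ x in (z - r)..(z + r), F x) - Real.pi * (φ z / |g' z|)|
        = |((∫ x in (z - r)..(z + r), F x) - φ z * T) + φ z * (T - Real.pi / |g' z|)| := by
          ring_nf
      _ ≤ |(∫ x in (z - r)..(z + r), F x) - φ z * T| + |φ z * (T - Real.pi / |g' z|)| :=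
          abs_add_le _ _
      _ ≤ ε * Kz z + |φ z| * abs (T - Real.pi / |g' z|) := by
          rw [abs_mul]
          exact add_le_add key le_rfl
  -- far estimate
  have hfar : |∫ x in Ioc a b \ U, F x| ≤ M / c ^ 2 * (b - a) * ν := by
    have hvol : volume (Ioc a b \ U) < ⊤ :=
      lt_of_le_of_lt (measure_mono sdiff_subset) (by rw [Real.volume_Ioc]; exact ENNReal.ofReal_lt_top)
    have hpt : ∀ x ∈ Ioc a b \ U, ‖F x‖ ≤ M * ν / c ^ 2 := by
      intro x hx
      have hxI : x ∈ Icc a b := Ioc_subset_Icc_self hx.1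
      have hxfar : ∀ z ∈ Z, r ≤ |x - z| := by
        intro z hz
        by_contra hlt
        push Not at hlt
        have hxB : x ∈ B z := by
          rw [abs_lt] at hlt
          exact ⟨by linarith [hlt.1], by linarith [hlt.2]⟩
        exact hx.2 (Set.mem_biUnion hz hxB)
      have hcx : c ≤ |g x| := hcfar x hxI hxfar
      have hφx : |φ x| ≤ M := by have := hM x hxI; rwa [Real.norm_eq_abs] at this
      rw [hF, Real.norm_eq_abs, abs_mul, abs_of_nonneg (by positivity : (0:ℝ) ≤ ν / (g x ^ 2 + ν ^ 2))]
      have hL : ν / (g x ^ 2 + ν ^ 2) ≤ ν / c ^ 2 := by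
        refine div_le_div_of_nonneg_left hνpos'.le (by positivity) ?_
        have : c ^ 2 ≤ |g x| ^ 2 := pow_le_pow_left₀ hc.le hcx 2
        rw [sq_abs] at this
        linarith [sq_nonneg ν]
      calc |φ x| * (ν / (g x ^ 2 + ν ^ 2)) ≤ M * (ν / c ^ 2) :=
            mul_le_mul hφx hL (by positivity) hM0
        _ = M * ν / c ^ 2 := by ring
    have h := norm_setIntegral_le_of_norm_le_const hvol hpt
    rw [Real.norm_eq_abs] at h
    refine h.trans ?_
    have hreal : volume.real (Ioc a b \ U) ≤ b - a := by
      calc volume.real (Ioc a b \ U) ≤ volume.real (Ioc a b) :=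
            measureReal_mono sdiff_subset (by rw [Real.volume_Ioc]; exact ENNReal.ofReal_ne_top)
        _ = b - a := by rw [measureReal_def, Real.volume_Ioc, ENNReal.toReal_ofReal (by linarith)]
    calc M * ν / c ^ 2 * volume.real (Ioc a b \ U) ≤ M * ν / c ^ 2 * (b - a) :=
          mul_le_mul_of_nonneg_left hreal (by positivity)
      _ = M / c ^ 2 * (b - a) * ν := by ring
  -- assemble
  rw [Real.dist_eq, hsplit, hUsum, Finset.mul_sum]
  have hsum_near : ∑ z ∈ Z, |(∫ x in B z, F x) - Real.pi * (φ z / |g' z|)| ≤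
      ε * S + ∑ z ∈ Z, |φ z| * abs (2 * Real.arctan (|g' z| * r / ν) / |g' z| - Real.pi / |g' z|) := by
    rw [hSdef, Finset.mul_sum, ← Finset.sum_add_distrib]
    exact Finset.sum_le_sum hnear
  have hsum_arctan : ∑ z ∈ Z, |φ z| * abs (2 * Real.arctan (|g' z| * r / ν) / |g' z| - Real.pi / |g' z|)
      ≤ η / 3 := by
    calc ∑ z ∈ Z, |φ z| * abs (2 * Real.arctan (|g' z| * r / ν) / |g' z| - Real.pi / |g' z|)
        ≤ ∑ z ∈ Z, η / (3 * (Z.card + 1)) := Finset.sum_le_sum (fun z hz => (hν2 z hz).le)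
      _ = Z.card * (η / (3 * (Z.card + 1))) := by rw [Finset.sum_const, nsmul_eq_mul]
      _ ≤ η / 3 := by
          rw [mul_div_assoc', div_le_div_iff₀ (by positivity) (by positivity)]
          nlinarith
  calc |((∫ x in Ioc a b \ U, F x) + ∑ z ∈ Z, ∫ x in B z, F x) - ∑ z ∈ Z, Real.pi * (φ z / |g' z|)|
      = |(∫ x in Ioc a b \ U, F x) + ∑ z ∈ Z, ((∫ x in B z, F x) - Real.pi * (φ z / |g' z|))| := by
        rw [Finset.sum_sub_distrib]; ring_nf
    _ ≤ |∫ x in Ioc a b \ U, F x| + |∑ z ∈ Z, ((∫ x in B z, F x) - Real.pi * (φ z / |g' z|))| :=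
        abs_add_le _ _
    _ ≤ |∫ x in Ioc a b \ U, F x| + ∑ z ∈ Z, |(∫ x in B z, F x) - Real.pi * (φ z / |g' z|)| := by
        gcongr; exact Finset.abs_sum_le_sum_abs _ _
    _ ≤ M / c ^ 2 * (b - a) * ν + (ε * S + η / 3) :=
        add_le_add hfar (hsum_near.trans (by linarith))
    _ < η := by linarith


/-- **Fibre lemma** (registered helper-stub form of `tendsto_setIntegral_lorentzian_of_simple_zeros'`):
`∫_{(a,b]} φ ν/(g²+ν²) → π Σ_{z ∈ Z} φ(z)/|g'(z)|` as `ν ↓ 0` for continuous `g, φ` on `[a,b]` with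
finitely many zeros of `g`, all simple and interior. [folklore] -/
theorem tendsto_setIntegral_lorentzian_of_simple_zeros : ∀ {a b : ℝ}, a ≤ b → ∀ {g g' φ : ℝ → ℝ}, ContinuousOn g (Set.Icc a b) → ContinuousOn φ (Set.Icc a b) → ∀ (Z : Finset ℝ), (∀ z ∈ Z, z ∈ Set.Ioo a b ∧ g z = 0 ∧ HasDerivAt g (g' z) z ∧ g' z ≠ 0) → (∀ x ∈ Set.Icc a b, g x = 0 → x ∈ Z) → Filter.Tendsto (fun ν : ℝ => ∫ x in Set.Ioc a b, φ x * (ν / (g x ^ 2 + ν ^ 2))) (nhdsWithin 0 (Set.Ioi 0)) (nhds (Real.pi * ∑ z ∈ Z, φ z / |g' z|)) :=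
  tendsto_setIntegral_lorentzian_of_simple_zeros'

end Summit.AtomisticToContinuum.FouriersLaw.Theorems.MourreDissolution.FibreLorentzian

end
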